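import Mathlib
import Summits.Ventures.PercRepro.TriangleCapSecondBestTable

/-!
# PercRepro — THE SECOND-BEST VALUE TWO BELOW THE DIAGONAL ON THE ROW `a = 4` BY PARITY, HENCE THE SECOND-BEST
VALUE OF THE CHERRY TABLE ON EVERY CELL WITH `r ≤ 2` WITHOUT EXCEPTION (p3, gen 44; part 197i)

`Σ_v d(v)²` is even on every graph (`d² ≡ d` mod `2`, `Σ_v d(v) = 2m`), and the closed form `m k − 2 (k − 3)` at
`r = 2` is even (`a (k − a) k` is even), so a non-extremal graph is at least `2` below, and `K_{4,k−4}` minus two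
disjoint cross pairs attains `2` (`matchingTwoGen`). So on the cell `(k, 4, 2)` — the one cell of part 197e's table
without a theorem — the second-best VALUE is `m k − 2 (k − 3) − 2` as well (the non-`4`-bipartite half, the
one-triangle family `T` against `B2`, stays open). `second_best_table'`: the table on every cell with `r ≤ 2`.
Axioms: standard.
-/

namespace PercRepro

namespace TriangleCap

namespace C047

open Finset

variable {V : Type*} [Fintype V] [DecidableEq V]

omit [DecidableEq V] in
/-- `Σ_v d(v)²` is even: `d² + d = d (d + 1)` is even and `Σ_v d(v) = 2m`. -/
theorem even_sum_deg_sq (D : SimpleGraph V) [DecidableRel D.Adj] : Even (∑ v, deg D v * deg D v) := by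
  have h1 : Even (∑ v, (deg D v * deg D v + deg D v)) := by
    apply Finset.even_sum
    intro v _
    have : deg D v * deg D v + deg D v = deg D v * (deg D v + 1) := by ring
    rw [this]
    exact Nat.even_mul_succ_self _
  rw [sum_add_distrib, sum_deg_eq] at h1
  have h2 : Even (2 * D.edgeFinset.card) := even_two_mul _
  exact (Nat.even_add.mp h1).mpr h2

/-- `a (k − a) k` is even (one of `a`, `k − a`, `k` is even). -/
theorem even_mul_sub_mul (a k : ℕ) (hk : a ≤ k) : Even (a * (k - a) * k) := by
  obtain ⟨t, rfl⟩ : ∃ t, k = a + t := ⟨k - a, by omega⟩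
  rw [Nat.add_sub_cancel_left]
  rcases Nat.even_or_odd a with ha | ha
  · exact (ha.mul_right t).mul_right (a + t)
  · rcases Nat.even_or_odd t with ht | ht
    · exact (ht.mul_left a).mul_right (a + t)
    · exact (ha.add_odd ht).mul_left (a * t)

/-- **THE SECOND-BEST VALUE ON THE CELL `(k, 4, 2)`, BY PARITY:** for `10 ≤ k`, every non-extremal `K₄⁻`-free graph
on `Fin k` with `4 (k − 4) − 2` edges has `Σ_v d(v)² + 2 (k − 3) + 2 ≤ m k`, and the value is attained. -/
theorem two_below_second_best_four (k : ℕ) (hk : 10 ≤ k) :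
    (∀ (D : SimpleGraph (Fin k)) [DecidableRel D.Adj], K4mFree D → D.edgeFinset.card + 2 = 4 * (k - 4) →
        ∑ v, deg D v * deg D v + 2 * (k - 3) ≠ D.edgeFinset.card * k →
        ∑ v, deg D v * deg D v + 2 * (k - 3) + 2 ≤ D.edgeFinset.card * k) ∧
      ∃ (D : SimpleGraph (Fin k)) (_ : DecidableRel D.Adj), K4mFree D ∧ D.edgeFinset.card + 2 = 4 * (k - 4) ∧
        ∑ v, deg D v * deg D v + 2 * (k - 3) + 2 = D.edgeFinset.card * k := by
  have hcard : Fintype.card (Fin k) = k := Fintype.card_fin k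
  refine ⟨?_, ?_⟩
  · intro D _ hK hm hne
    have hle := closed_form_stability D hK 4 2 (by norm_num) (by rw [hcard]; omega)
      (by rw [hcard]; exact below_cap_arith 4 k D.edgeFinset.card 2 (by omega) hm)
    rw [hcard] at hle
    have e : k - 1 - 2 = k - 3 := by omega
    rw [e] at hle
    obtain ⟨p, hp⟩ := even_sum_deg_sq D
    obtain ⟨q, hq⟩ : Even (D.edgeFinset.card * k) := by
      have h1 := even_mul_sub_mul 4 k (by omega)
      have h2 : D.edgeFinset.card * k + 2 * k = 4 * (k - 4) * k := by
        rw [← add_mul, hm]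
      have h3 : Even (D.edgeFinset.card * k + 2 * k) := by rw [h2]; exact h1
      exact (Nat.even_add.mp h3).mpr (even_two_mul k)
    omega
  · obtain ⟨hK, hE, hS⟩ := matchingTwoGen_value k 4 (by norm_num) (by omega) (by omega)
    have e : k - 1 - 2 = k - 3 := by omega
    rw [e] at hS
    exact ⟨matchingTwoGen k 4 (by omega), inferInstance, hK, hE, hS⟩

/-- **THE SECOND-BEST VALUE OF THE `K₄⁻`-FREE CHERRY TABLE ON EVERY CELL `(k, a, r)` WITH `r ≤ 2`, NO EXCEPTION**
(`3 ≤ a`, `2a + 2 ≤ k`, `r + 7 ≤ k` on the row `a = 3`): `closed − secondGap k a r`. -/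
theorem second_best_table' (k a r : ℕ) (ha : 3 ≤ a) (hr : r ≤ 2) (hk : 2 * a + 2 ≤ k) (hk3 : a = 3 → r + 7 ≤ k) :
    (∀ (D : SimpleGraph (Fin k)) [DecidableRel D.Adj], K4mFree D → D.edgeFinset.card + r = a * (k - a) →
        ∑ v, deg D v * deg D v + r * (k - 1 - r) ≠ D.edgeFinset.card * k →
        ∑ v, deg D v * deg D v + r * (k - 1 - r) + secondGap k a r ≤ D.edgeFinset.card * k) ∧
      ∃ (D : SimpleGraph (Fin k)) (_ : DecidableRel D.Adj), K4mFree D ∧ D.edgeFinset.card + r = a * (k - a) ∧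
        ∑ v, deg D v * deg D v + r * (k - 1 - r) + secondGap k a r = D.edgeFinset.card * k := by
  by_cases h42 : a = 4 ∧ r = 2
  · obtain ⟨rfl, rfl⟩ := h42
    obtain ⟨h1, D, inst, hK, hE, hS⟩ := two_below_second_best_four k (by omega)
    simp only [secondGap] at h1 hS ⊢
    have e : k - 1 - 2 = k - 3 := by omega
    rw [e]
    exact ⟨fun D _ hK hm hne => h1 D hK hm hne, D, inst, hK, hE, hS⟩
  · exact second_best_table k a r ha hr hk hk3 h42

end C047

end TriangleCap

end PercRepro
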